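import Summits.Ventures.LatticeQCDFlow.TrivializingMaps.FisherZerosCarryVariance
import Summits.Ventures.LatticeQCDFlow.TrivializingMaps.FisherZeroRadiusSharp

/-!
HONEST FRAMING: exact (Metropolis-corrected) sampling algorithms for lattice gauge theory; figures
of merit are autocorrelation/cost numbers at stated couplings and volumes; no continuum-physics
claim.

# FisherZerosExtensive — the zeros of the Laplace transform of a bounded random variable inside
# `|z| < R` have multiplicities summing to at least `ρ²·(Var X − 4|b|/R)` (lean-2 GEN-7, ours)

Venture-side (OURS).  Cell `lqcd-flow` (pub-lqcd), unit `pub-lqcd-lean-2-g7`, 2026-08-22.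

This file DISCHARGES the Blaschke-factorisation hypothesis of `FisherZerosCarryVariance` with
Mathlib's divisor machinery (`MeromorphicOn.extract_zeros_poles` on the closed disc of radius `2R`;
the zeros of the open disc of radius `R` are divided out by Blaschke factors, all other factors are
kept in the zero-free quotient):

* **`exists_zeros_sum_divisor_ge`** — `|X| ≤ b` a.e. under a probability measure,
  `Z = complexMGF X μ` zero-free on `|z| < ρ` (`ρ > 0`), `R > 0`: there is a finite set `T` of zeros
  of `Z` with `ρ ≤ |u| < R` whose multiplicities (`divisor Z (closedBall 0 (2R)) u ≥ 1`) sum to at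
  least `ρ²·(Var X − 4|b|/R)`; **`exists_zeros_sum_divisor_ge_centred`** — the same with a half-range
  `b` about any centre `c` (`|X − c| ≤ b`; the MGF of `X − c` is `e^{-zc}·Z`, same divisor).

Reading for the lattice (value-free; docked in `WilsonFisherZerosExtensive`): for the `SU(n)` Wilson
action in volume `L` (centre = half-range = `n·#plaq`, `Var_{D[U]}(S_W) = m₂(n)·#plaq`, THEOREM-A
zero-free radius `ρ` uniform in `L`) the Fisher zeros of `Z_L` in `|s| < R` have total multiplicity
`≥ ρ²·#plaq·(m₂(n) − 4n/R)`: for `R > 4n/m₂(n)` the number of Fisher zeros in a FIXED disc grows at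
least linearly with the number of plaquettes.

NOT CLAIMED: any count for any concrete volume, coupling or group; the value of `ρ`; cost /
autocorrelation / continuum statements.
-/

noncomputable section

open MeasureTheory ProbabilityTheory Complex Metric Set Filter Topology MeromorphicOn
open scoped ComplexConjugate

namespace Summit.Ventures.LatticeQCDFlow.TrivializingMaps

variable {Ω : Type*} [MeasurableSpace Ω] {μ : Measure Ω} [IsProbabilityMeasure μ]
  {X : Ω → ℝ} {b : ℝ}

/-- **The zeros inside `|z| < R` have total multiplicity at least `ρ²·(Var X − 4|b|/R)`.**
`|X| ≤ b` a.e. under a probability measure; `Z = complexMGF X μ` zero-free on `|z| < ρ` (`ρ > 0`);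
`R > 0`.  Then there is a finite set `T` of zeros of `Z` with `ρ ≤ |u| < R` such that
`ρ²·(Var X − 4|b|/R) ≤ ∑_{u ∈ T} divisor Z (closedBall 0 (2R)) u` (each summand is the
multiplicity of the zero `u`, a positive integer). [ours] -/
theorem exists_zeros_sum_divisor_ge (hm : AEMeasurable X μ) (hb : ∀ᵐ ω ∂μ, |X ω| ≤ b)
    {R ρ : ℝ} (hR : 0 < R) (hρ : 0 < ρ)
    (hfree : ∀ z : ℂ, ‖z‖ < ρ → complexMGF X μ z ≠ 0) :
    ∃ T : Finset ℂ, (∀ u ∈ T, complexMGF X μ u = 0 ∧ ρ ≤ ‖u‖ ∧ ‖u‖ < R ∧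
        1 ≤ MeromorphicOn.divisor (complexMGF X μ) (closedBall (0 : ℂ) (2 * R)) u) ∧
      ρ ^ 2 * (variance X μ - 4 * |b| / R) ≤
        ∑ u ∈ T, (MeromorphicOn.divisor (complexMGF X μ) (closedBall (0 : ℂ) (2 * R)) u : ℝ) := by
  set Z := complexMGF X μ with hZdef
  set U : Set ℂ := closedBall (0 : ℂ) (2 * R) with hUdef
  have hZd : Differentiable ℂ Z := ZeroPinching.differentiable_complexMGF_of_abs_le hm hb
  have hZ0 : Z 0 = 1 := by
    rw [hZdef, show (0 : ℂ) = ((0 : ℝ) : ℂ) from Complex.ofReal_zero.symm, complexMGF_ofReal,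
      mgf_zero]
    simp
  have hZU : AnalyticOnNhd ℂ Z U := fun z _ => hZd.analyticAt z
  have hZuniv : AnalyticOnNhd ℂ Z univ := fun z _ => hZd.analyticAt z
  -- orders are finite: `Z` is not locally zero anywhere (identity theorem, `Z 0 = 1`)
  have h₂ : ∀ u : U, meromorphicOrderAt Z u ≠ ⊤ := by
    intro ⟨u, hu⟩ htop
    rw [meromorphicOrderAt_eq_top_iff] at htop
    rcases (hZd.analyticAt u).eventually_eq_zero_or_eventually_ne_zero with h0 | hne
    · have hzero := hZuniv.eqOn_zero_of_preconnected_of_eventuallyEq_zero isPreconnected_univ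
        (mem_univ u) h0
      have : Z 0 = 0 := hzero (mem_univ 0)
      rw [hZ0] at this
      exact one_ne_zero this
    · have : ∀ᶠ z in 𝓝[≠] u, False := by
        filter_upwards [htop, hne] with z h1 h2 using h2 h1
      exact (NormedField.nhdsNE_neBot u).ne (Filter.eventually_false_iff_eq_bot.mp this)
  set D := MeromorphicOn.divisor Z U with hDdef
  have hDfin : D.support.Finite := D.finiteSupport (isCompact_closedBall _ _)
  have hD0 : ∀ u, 0 ≤ D u := fun u => AnalyticOnNhd.divisor_nonneg hZU u
  obtain ⟨g, hgU, hg0, hfg⟩ := hZU.meromorphicOn.extract_zeros_poles h₂ hDfin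
  -- pointwise identity on the open ball of radius `2R`
  set F : ℂ → ℂ := fun z => (∏ᶠ u, (z - u) ^ D u) * g z with hFdef
  have hFeq : ((∏ᶠ u, (· - u) ^ D u) • g : ℂ → ℂ) = F := by
    funext z
    simp only [hFdef, Pi.smul_apply', smul_eq_mul]
    rw [Function.FactorizedRational.finprod_eq_fun hDfin]
  rw [hFeq] at hfg
  have hFan : ∀ z ∈ U, AnalyticAt ℂ F z := fun z hz => by
    have h1 : AnalyticAt ℂ (∏ᶠ u, (· - u) ^ D u) z :=
      Function.FactorizedRational.analyticAt (hD0 z)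
    rw [Function.FactorizedRational.finprod_eq_fun hDfin] at h1
    exact h1.mul (hgU z hz)
  have hpt : ∀ z ∈ ball (0 : ℂ) (2 * R), Z z = F z := by
    intro z hz
    have hzU : z ∈ U := ball_subset_closedBall hz
    have hS := (mem_codiscreteWithin_iff_forall_mem_nhdsNE.mp hfg) z hzU
    have hUn : ∀ᶠ y in 𝓝[≠] z, y ∈ U :=
      mem_nhdsWithin_of_mem_nhds (mem_of_superset (isOpen_ball.mem_nhds hz) ball_subset_closedBall)
    have hev : Z =ᶠ[𝓝[≠] z] F := by
      filter_upwards [hS, hUn] with y hy hyU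
      rcases hy with hy | hy
      · exact hy
      · exact absurd hyU hy
    -- continuous functions agreeing on a punctured neighbourhood agree at the point
    exact tendsto_nhds_unique
      ((hZd.continuous.continuousAt.tendsto.mono_left nhdsWithin_le_nhds).congr' hev)
      ((hFan z hzU).continuousAt.tendsto.mono_left nhdsWithin_le_nhds)
  -- the finite set of zeros and the multiplicities
  set S : Finset ℂ := hDfin.toFinset with hSdef
  set T : Finset ℂ := S.filter fun u => ‖u‖ < R with hTdef
  set S' : Finset ℂ := S.filter fun u => ¬ ‖u‖ < R with hS'def
  set m : ℂ → ℕ := fun u => (D u).toNat with hmdef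
  have hmD : ∀ u, ((m u : ℕ) : ℤ) = D u := fun u => Int.toNat_of_nonneg (hD0 u)
  have hmemS : ∀ u, u ∈ S ↔ D u ≠ 0 := fun u => by simp [hSdef]
  -- zeros: `u ∈ S` iff `D u ≠ 0`; then `Z u = 0` and `u ≠ 0`, `|u| ≥ ρ`
  have hzero_of_mem : ∀ u ∈ S, Z u = 0 := by
    intro u hu
    have hDu : D u ≠ 0 := (hmemS u).mp hu
    have huU : u ∈ U := by
      by_contra hnot
      exact hDu (Function.locallyFinsuppWithin.apply_eq_zero_of_notMem D hnot)
    by_contra hZu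
    have hord : analyticOrderAt Z u = 0 := (hZU u huU).analyticOrderAt_eq_zero.mpr hZu
    have : D u = 0 := by
      rw [hDdef, AnalyticOnNhd.divisor_apply hZU huU, hord]
      simp
    exact hDu this
  have hnorm_of_mem : ∀ u ∈ S, ρ ≤ ‖u‖ := fun u hu => by
    by_contra hlt
    push Not at hlt
    exact hfree u hlt (hzero_of_mem u hu)
  have hT : ∀ u ∈ T, u ≠ 0 ∧ ‖u‖ < R := fun u hu => by
    rw [hTdef, Finset.mem_filter] at hu
    refine ⟨fun h0 => ?_, hu.2⟩
    have := hnorm_of_mem u hu.1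
    rw [h0, norm_zero] at this
    linarith
  -- the factorisation on `|z| < 2R`: `Z z = g z · ∏_{S} (z-u)^{m u}`
  have hZprod : ∀ z ∈ ball (0 : ℂ) (2 * R), Z z = g z * ∏ u ∈ S, (z - u) ^ m u := by
    intro z hz
    rw [hpt z hz, hFdef]
    simp only
    rw [finprod_eq_prod_of_mulSupport_subset (s := S) _ ?_, mul_comm]
    · congr 1
      refine Finset.prod_congr rfl fun u _ => ?_
      rw [← hmD u, zpow_natCast]
    · intro u hu
      rw [Function.mem_mulSupport] at hu
      simp only [hSdef, Set.Finite.coe_toFinset, Function.mem_support]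
      intro hDu
      rw [hDu, zpow_zero] at hu
      exact hu rfl
  -- the Blaschke quotient `h`
  have hR0 : (R : ℂ) ≠ 0 := by exact_mod_cast hR.ne'
  set h : ℂ → ℂ := fun z => g z * (∏ u ∈ S', (z - u) ^ m u) *
    ∏ u ∈ T, (((R : ℂ) ^ 2 - conj u * z) / R) ^ m u with hhdef
  have hgd : DifferentiableOn ℂ g (closedBall 0 R) := fun z hz =>
    (hgU z (closedBall_subset_closedBall (by linarith) hz)).differentiableAt.differentiableWithinAt
  have hpoly1 : Differentiable ℂ fun z : ℂ => ∏ u ∈ S', (z - u) ^ m u := by fun_prop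
  have hpoly2 : Differentiable ℂ fun z : ℂ => ∏ u ∈ T, (((R : ℂ) ^ 2 - conj u * z) / R) ^ m u := by
    fun_prop
  have hhd : DifferentiableOn ℂ h (closedBall 0 R) := by
    simp only [hhdef]
    exact (hgd.mul hpoly1.differentiableOn).mul hpoly2.differentiableOn
  have hh0 : ∀ z ∈ ball (0 : ℂ) R, h z ≠ 0 := by
    intro z hz
    have hzR : ‖z‖ < R := mem_ball_zero_iff.mp hz
    have hzU : z ∈ U := mem_closedBall_zero_iff.mpr (by linarith)
    simp only [hhdef]
    refine mul_ne_zero (mul_ne_zero (hg0 ⟨z, hzU⟩) ?_) ?_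
    · refine Finset.prod_ne_zero_iff.mpr fun u hu => pow_ne_zero _ ?_
      rw [hS'def, Finset.mem_filter] at hu
      intro hzu
      rw [sub_eq_zero] at hzu
      rw [hzu] at hzR
      exact hu.2 hzR
    · refine Finset.prod_ne_zero_iff.mpr fun u hu => pow_ne_zero _ ?_
      exact div_ne_zero (Blaschke.sq_sub_conj_mul_ne_zero hR (hT u hu).2 hzR.le) hR0
  have hfh : ∀ z ∈ closedBall (0 : ℂ) R,
      Z z * ∏ u ∈ T, ((R : ℂ) ^ 2 - conj u * z) ^ m u =
        h z * ∏ u ∈ T, ((R : ℂ) * (z - u)) ^ m u := by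
    intro z hz
    have hzb : z ∈ ball (0 : ℂ) (2 * R) :=
      mem_ball_zero_iff.mpr (by linarith [mem_closedBall_zero_iff.mp hz])
    rw [hZprod z hzb, hhdef]
    simp only
    rw [← Finset.prod_filter_mul_prod_filter_not S (fun u => ‖u‖ < R)]
    -- `∏_T (z-u)^m · ∏_T (R²-ūz)^m = ∏_T ((R²-ūz)/R)^m · ∏_T (R(z-u))^m`
    have key : (∏ u ∈ T, (z - u) ^ m u) * ∏ u ∈ T, ((R : ℂ) ^ 2 - conj u * z) ^ m u =
        (∏ u ∈ T, (((R : ℂ) ^ 2 - conj u * z) / R) ^ m u) *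
          ∏ u ∈ T, ((R : ℂ) * (z - u)) ^ m u := by
      rw [← Finset.prod_mul_distrib, ← Finset.prod_mul_distrib]
      refine Finset.prod_congr rfl fun u _ => ?_
      rw [← mul_pow, ← mul_pow]
      congr 1
      field_simp
    rw [show S.filter (fun u => ‖u‖ < R) = T from rfl,
      show S.filter (fun u => ¬‖u‖ < R) = S' from rfl]
    calc g z * ((∏ u ∈ T, (z - u) ^ m u) * ∏ u ∈ S', (z - u) ^ m u) *
          ∏ u ∈ T, ((R : ℂ) ^ 2 - conj u * z) ^ m u
        = g z * (∏ u ∈ S', (z - u) ^ m u) *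
          ((∏ u ∈ T, (z - u) ^ m u) * ∏ u ∈ T, ((R : ℂ) ^ 2 - conj u * z) ^ m u) := by ring
      _ = g z * (∏ u ∈ S', (z - u) ^ m u) * ((∏ u ∈ T, (((R : ℂ) ^ 2 - conj u * z) / R) ^ m u) *
          ∏ u ∈ T, ((R : ℂ) * (z - u)) ^ m u) := by rw [key]
      _ = g z * (∏ u ∈ S', (z - u) ^ m u) * (∏ u ∈ T, (((R : ℂ) ^ 2 - conj u * z) / R) ^ m u) *
          ∏ u ∈ T, ((R : ℂ) * (z - u)) ^ m u := by ring
  -- apply the carrying-variance theorem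
  have hTρ : ∀ u ∈ T, ρ ≤ ‖u‖ := fun u hu => by
    rw [hTdef, Finset.mem_filter] at hu
    exact hnorm_of_mem u hu.1
  have hmain := card_zeros_ge_of_blaschkeFactorization hm hb hR hρ T m hT hTρ hhd hh0 hfh
  refine ⟨T, fun u hu => ?_, ?_⟩
  · have huS : u ∈ S := by rw [hTdef, Finset.mem_filter] at hu; exact hu.1
    refine ⟨hzero_of_mem u huS, hTρ u hu, (hT u hu).2, ?_⟩
    have hDu : D u ≠ 0 := (hmemS u).mp huS
    have := hD0 u
    omega
  · calc ρ ^ 2 * (variance X μ - 4 * |b| / R) ≤ ∑ u ∈ T, (m u : ℝ) := hmain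
      _ = ∑ u ∈ T, (D u : ℝ) := Finset.sum_congr rfl fun u _ => by
          rw [← hmD u]; norm_cast


/-- **Centred form** (half-range `b` about any centre `c`): `|X − c| ≤ b` a.e., `Z = complexMGF X μ`
zero-free on `|z| < ρ`, `R > 0` `⇒` zeros of `Z` with `ρ ≤ |u| < R` of total multiplicity at least
`ρ²·(Var X − 4|b|/R)`.  (The MGF of `X − c` is `e^{-zc}·Z`: same zeros, same divisor.) [ours] -/
theorem exists_zeros_sum_divisor_ge_centred (hm : AEMeasurable X μ) {c : ℝ}
    (hb : ∀ᵐ ω ∂μ, |X ω - c| ≤ b) {R ρ : ℝ} (hR : 0 < R) (hρ : 0 < ρ)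
    (hfree : ∀ z : ℂ, ‖z‖ < ρ → complexMGF X μ z ≠ 0) :
    ∃ T : Finset ℂ, (∀ u ∈ T, complexMGF X μ u = 0 ∧ ρ ≤ ‖u‖ ∧ ‖u‖ < R ∧
        1 ≤ MeromorphicOn.divisor (complexMGF X μ) (closedBall (0 : ℂ) (2 * R)) u) ∧
      ρ ^ 2 * (variance X μ - 4 * |b| / R) ≤
        ∑ u ∈ T, (MeromorphicOn.divisor (complexMGF X μ) (closedBall (0 : ℂ) (2 * R)) u : ℝ) := by
  set Y : Ω → ℝ := fun ω => X ω - c with hYdef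
  have hmY : AEMeasurable Y μ := hm.sub_const c
  have hZY : complexMGF Y μ = fun z => exp (-(z * c)) * complexMGF X μ z :=
    funext fun z => complexMGF_sub_const X μ c z
  have hfreeY : ∀ z : ℂ, ‖z‖ < ρ → complexMGF Y μ z ≠ 0 := fun z hz => by
    rw [hZY]; exact mul_ne_zero (Complex.exp_ne_zero _) (hfree z hz)
  obtain ⟨T, hT, hsum⟩ := exists_zeros_sum_divisor_ge (μ := μ) (X := Y) hmY hb hR hρ hfreeY
  -- the divisors of `Z_Y = e^{-zc} Z_X` and `Z_X` agree on the closed disc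
  set U : Set ℂ := closedBall (0 : ℂ) (2 * R) with hUdef
  have hb0 : ∀ᵐ ω ∂μ, |X ω| ≤ |c| + b := hb.mono fun ω hω => by
    calc |X ω| = |(X ω - c) + c| := by rw [sub_add_cancel]
      _ ≤ |X ω - c| + |c| := abs_add_le _ _
      _ ≤ |c| + b := by linarith
  have hZd : Differentiable ℂ (complexMGF X μ) :=
    ZeroPinching.differentiable_complexMGF_of_abs_le hm hb0
  have hEd : Differentiable ℂ (fun z : ℂ => exp (-(z * c))) := by fun_prop
  have hZU : AnalyticOnNhd ℂ (complexMGF X μ) U := fun z _ => hZd.analyticAt z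
  have hEU : AnalyticOnNhd ℂ (fun z : ℂ => exp (-(z * c))) U := fun z _ => hEd.analyticAt z
  have hZ0 : complexMGF X μ 0 = 1 := by
    rw [show (0 : ℂ) = ((0 : ℝ) : ℂ) from Complex.ofReal_zero.symm, complexMGF_ofReal, mgf_zero]
    simp
  have hE_ord : ∀ z ∈ U, meromorphicOrderAt (fun z : ℂ => exp (-(z * c))) z ≠ ⊤ := fun z hz => by
    rw [(hEU z hz).meromorphicOrderAt_eq,
      (hEU z hz).analyticOrderAt_eq_zero.mpr (Complex.exp_ne_zero _)]
    simp
  have hZ_ord : ∀ z ∈ U, meromorphicOrderAt (complexMGF X μ) z ≠ ⊤ := by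
    intro u _ htop
    rw [meromorphicOrderAt_eq_top_iff] at htop
    rcases (hZd.analyticAt u).eventually_eq_zero_or_eventually_ne_zero with h0 | hne
    · have hZuniv : AnalyticOnNhd ℂ (complexMGF X μ) univ := fun z _ => hZd.analyticAt z
      have hzero := hZuniv.eqOn_zero_of_preconnected_of_eventuallyEq_zero isPreconnected_univ
        (mem_univ u) h0
      have : complexMGF X μ 0 = 0 := hzero (mem_univ 0)
      rw [hZ0] at this
      exact one_ne_zero this
    · have : ∀ᶠ z in 𝓝[≠] u, False := by
        filter_upwards [htop, hne] with z h1 h2 using h2 h1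
      exact (NormedField.nhdsNE_neBot u).ne (Filter.eventually_false_iff_eq_bot.mp this)
  have hdivE : MeromorphicOn.divisor (fun z : ℂ => exp (-(z * c))) U = 0 := by
    ext z
    by_cases hz : z ∈ U
    · rw [AnalyticOnNhd.divisor_apply hEU hz,
        (hEU z hz).analyticOrderAt_eq_zero.mpr (Complex.exp_ne_zero _)]
      simp
    · simp [hz]
  have hdiv : MeromorphicOn.divisor (complexMGF Y μ) U = MeromorphicOn.divisor (complexMGF X μ) U := by
    rw [hZY, MeromorphicOn.divisor_fun_mul hEU.meromorphicOn hZU.meromorphicOn hE_ord hZ_ord, hdivE,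
      zero_add]
  refine ⟨T, fun u hu => ?_, ?_⟩
  · obtain ⟨h1, h2, h3, h4⟩ := hT u hu
    refine ⟨?_, h2, h3, ?_⟩
    · rw [hZY] at h1
      rcases mul_eq_zero.mp h1 with h | h
      · exact absurd h (Complex.exp_ne_zero _)
      · exact h
    · rw [hdiv] at h4; exact h4
  · rw [variance_sub_const hm.aestronglyMeasurable] at hsum
    simp_rw [hdiv] at hsum
    exact hsum

end Summit.Ventures.LatticeQCDFlow.TrivializingMaps

end
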